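import Summits.ABC.IUTFork.Cor312SlotLicenceExactContentK
import Summits.ABC.IUTFork.Cor312HullContentInclusionExact
import Literature.IUT.LogVolume.TensorPacketLicenceCellInhabited
import HarnessLib

/-!
# [IUTchIII] Cor. 3.12, Step (xi-f) at the K-LEVEL sharp setting — readings (P) and (U) AGREE AT THE LICENCE LEVEL wherever the Θ-idele NORMS are
# CONSTANT ON THE FIBRES: `qRegion ⊆ slot hull ↔ qRegion ⊆ full hull` per packet `(i+1, p)`, `SlotLicence ↔ Licence` globally

PROOF-ONLY file (D-0012; no definitions, no `Prop` facts, no instances) of the abc-iut cell (branch C certificate seat abc-iut-C-cert-2 gen 4; row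
«P:M-SLOT-LICENCE-EXACT», K corollary; K twin of this seat's `Cor312SlotLicenceSingletonFibresM`, p473654, with the subsingleton hypothesis RELAXED to
norm-constancy). TAKES NO SIDE on [IUTchIII] Cor. 3.12 (kurims manuscript p. 173–174; Step (x) p. 181, Step (xi-f) p. 184) or on the reading (U)/(P).

At abc-iut-c312-7's print-normalised sharp setting `settingPrVolSharp X hlog … tq t htq0 htq1` the two EXACT per-packet deciders — abc-iut-w4-d092's for the
(U) licence (`qRegion_subset_thetaHull_settingPrVolSharp_iff_of_content_isMaxOn`, p461xxx: hull of the union of ALL possible images; one integer = the exact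
content of the (Ind1)-slot UNION `⋃_a ι_a(t_{Θ,i,v_a})·(R_I)^∼`) and this seat's for the (P) SLOT licence (`qRegion_subset_thetaSlotHull_settingPrVolSharp_iff_of_content`,
p471782: the exact content of the LAST-slot box alone) — have the same right-hand side `‖t_{q,v_{i+1}}‖` vs `p^{−m}·∏_a ν(v_a)`. The content of a slot box
`ι_a(y)·(R_I)^∼` depends on `y` only through `‖y‖` and NOT on the slot `a` (abc-iut-c312-5's exact cell `iota_smul_normalizedPacket_subset_zpow_smul_logPacket_iff`,
radii witnesses by abc-iut-w4-d026 `exists_shellRadii_witnesses`). Hence at a packet `(i+1, p)` where the norms `‖t_{Θ,i,v}‖` do NOT depend on the place `v` of `F`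
over `p` (`hΘ`), the slot union and the last-slot box have the SAME exact content at every summand, and:

* **`qRegion_subset_thetaSlotHull_iff_thetaHull_settingPrVolSharp_of_norm_const`** — per packet `(i+1, p)`: `qRegion ⊆ slot hull ↔ qRegion ⊆ full hull`;
* **`slotLicence_iff_licence_settingPrVolSharp_of_norm_const`** — `SlotLicence ↔ Thm311ToCor312.Licence` when `hΘ` holds at every prime and label
  (archimedean packet automatic on both sides); `not_licence_of_not_slotLicence_settingPrVolSharp_of_norm_const` — then a failure of the SLOT licence (the
  antecedent of the γ / joint K binders hNumPOffBad / hNumPOffC / hNumJoint / hNumJointC, p462946 / p464071 / p464272) is a failure of the (U) licence, hence of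
  the q-pinned S_H (abc-iut-w5-d068 `licence_of_pilotKummerCompatHull`).

HONEST SCOPE: `hΘ` is a HYPOTHESIS on the Θ-ideles, stated, not discharged here (for the CHOSEN realising ideles of a genuine datum it says the Θ-pilot divisor's
local terms `θ_i(v)·log N(v)/n_v` are place-symmetric over each prime — abc-iut-s2-p7's `log ‖t‖` formula; its verification per datum class is for the S-chain
seats); statements about OUR typed objects; nothing here bears on the printed GLOBAL inequality or takes a side on any author; decided-as-typed ≠ in print;
typed ≠ proved (these: proved). [cite: Mochizuki2012, IUTchIII Cor. 3.12 p. 173–174, Step (x) p. 181, Step (xi-f) p. 184; Thm. 3.11 (i) (Ind1)(Ind2) p. 154;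
IUTchIV Prop. 1.1 p. 9, Prop. 1.2 (i)(ii) p. 10] [cite: DupuyHilado2025, §3.9, §4.9, §4.11–4.12] [claim: Mochizuki2012, status: disputed] for every IUT
sentence quoted.
-/

noncomputable section

open Set Function NumberField IsDedekindDomain
open scoped Pointwise

namespace Summit.ABC.IUTFork.Thm311.Real

open Cor312 Cor312Vol Literature.IUT.LogThetaLattice Literature.IUT.LogVolume
  Literature.NumberTheory.NumberFields Literature.NumberTheory.GaloisRepresentations.Ultrametric

variable {F : Type} [Field F] [NumberField F] (X : PilotData F) {logv : PadicLogs F} (hlog : LogvAnalytic logv)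
  (M : Type) [Field M] [NumberField M]
  (archPk : ∀ (j : (thetaIndex X).Label) (vQ : (thetaIndex X).VQ), Set ((logShellsDH X logv).Packet j vQ))
  (archSub : ∀ (j : (thetaIndex X).Label) (v : (thetaIndex X).V),
    Set ((logShellsDH X logv).Packet j ((thetaIndex X).over v)))
  (Ψ : ℤ → ∀ v : (thetaIndex X).V, v ∈ (thetaIndex X).Vbad → Set ((logShellsDH X logv).StarPacket v))
  (act : ℤ → ∀ v : (thetaIndex X).V, v ∈ (thetaIndex X).Vbad →
    (logShellsDH X logv).StarPacket v → Module.End ℚ ((logShellsDH X logv).StarPacket v))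
  (Mmod : ℤ → ∀ j : (thetaIndex X).LabelStar, Set ((logShellsDH X logv).GlobalPacket j.1))
  (region : ℤ → ∀ j : (thetaIndex X).LabelStar, FinDivisor M → ∀ vQ : (thetaIndex X).VQ,
    Set ((logShellsDH X logv).Packet j.1 vQ))
  (n : ℤ) {HT : Type} {LogLink : HT → HT → Type} {IsFull : ∀ {s t : HT}, LogLink s t → Prop}
  (lat : LGPGaussianLogThetaLattice LogLink IsFull)
  {Frd : Type} {IsoF : Frd → Frd → Type} {Ob : Frd → Type} {realify : Frd → Frd} {Strip : Type}
  {IsoS : Strip → Strip → Type} {Mv : ∀ v : (thetaIndex X).V, v ∈ (thetaIndex X).Vbad → Type}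
  [∀ v h, Monoid (Mv v h)]
  (sig : GlobalLGPFrobenioidSignature (thetaIndex X).lstar (thetaIndex X).V (· ∈ (thetaIndex X).Vbad)
    Frd IsoF Ob realify Strip IsoS Mv)
  (split : SplittingMonoids Mv) {ObΔ : Type} {N : ∀ v : (thetaIndex X).V, v ∈ (thetaIndex X).Vbad → Type}
  [∀ v h, Monoid (N v h)] (qData : QPilotData ObΔ N)
  (t : ∀ (pp : Nat.Primes) (_ : Fin X.lstar) (x : (thetaIndex X).Fibre (.inr pp)),
    haveI : Fact (pp : ℕ).Prime := ⟨pp.2⟩; kOf X pp.1 x)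
  (tq : ∀ (pp : Nat.Primes) (x : (thetaIndex X).Fibre (.inr pp)), haveI : Fact (pp : ℕ).Prime := ⟨pp.2⟩; kOf X pp.1 x)
  (htq0 : ∀ pp x, tq pp x ≠ 0)
  (htq1 : ∀ (pp : Nat.Primes) (x : (thetaIndex X).Fibre (.inr pp)),
    haveI : Fact (pp : ℕ).Prime := ⟨pp.2⟩; placeOf X pp.1 x ∉ X.S → ‖tq pp x‖ = 1)


/-! ## §1. (P) = (U) per packet when the Θ-idele norms are constant on the fibre -/

/-- **Per packet `(i+1, p)`, `qRegion ⊆ slot hull ↔ qRegion ⊆ full hull` when the norms `‖t_{Θ,i,v}‖` do not depend on the place `v` over `p`**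
(non-zero Θ-ideles). The slot union and the last-slot box have the same exact content at every summand (abc-iut-c312-5's cell reads the slot idele only
through its norm), so abc-iut-w4-d092's (U) criterion and this seat's (P) criterion coincide. [cite: Mochizuki2012, IUTchIII Cor. 3.12 Step (x) p. 181,
Step (xi-f) p. 184; Thm. 3.11 (i) (Ind1) p. 154] [cite: DupuyHilado2025, §4.9, §4.11–4.12] -/
theorem qRegion_subset_thetaSlotHull_iff_thetaHull_settingPrVolSharp_of_norm_const (ht0 : ∀ pp i x, t pp i x ≠ 0)
    (i : Fin (thetaIndex X).lstar) (pp : Nat.Primes)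
    (hΘ : ∀ x y : (thetaIndex X).Fibre (.inr pp), ‖t pp i x‖ = ‖t pp i y‖) :
    (settingPrVolSharp X hlog M archPk archSub Ψ act Mmod region n lat sig split qData tq t htq0 htq1).qRegion (Setting.labelSucc i) (.inr pp) ⊆ (settingPrVolSharp X hlog M archPk archSub Ψ act Mmod region n lat sig split qData tq t htq0 htq1).thetaSlotHull (Setting.labelSucc i) (.inr pp) ↔
    (settingPrVolSharp X hlog M archPk archSub Ψ act Mmod region n lat sig split qData tq t htq0 htq1).qRegion (Setting.labelSucc i) (.inr pp) ⊆ (settingPrVolSharp X hlog M archPk archSub Ψ act Mmod region n lat sig split qData tq t htq0 htq1).thetaHull (Setting.labelSucc i) (.inr pp) := by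
  classical
  haveI : Fact (pp : ℕ).Prime := ⟨pp.2⟩
  -- outer-radius elements of largest norm and inner-radius witnesses at every place over `p`
  have hν := fun x : (thetaIndex X).Fibre (.inr pp) => exists_norm_isMaxOn_logUnits pp.1 (K := kOf X pp.1 x)
  choose ν hνmem hν using hν
  have hw := fun x : (thetaIndex X).Fibre (.inr pp) => exists_shellRadii_witnesses pp.1 (K := kOf X pp.1 x)
  choose cin _cout hin0 hin hmax _h1 _h2 _h3 using hw
  -- the exact content of the LAST-slot box at every summand
  have hne : ∀ e : (thetaIndex X).Caps (Setting.labelSucc i) → (thetaIndex X).Fibre (.inr pp),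
      ∃ x ∈ iota pp.1 ((presAtPr X hlog pp).kk e) (Fin.last _) (t pp i (e (Fin.last _))) •
          (normalizedPacket pp.1 ((presAtPr X hlog pp).kk e) : Set ((presAtPr X hlog pp).X e)), x ≠ 0 := by
    intro e
    refine ⟨iota pp.1 ((presAtPr X hlog pp).kk e) (Fin.last _) (t pp i (e (Fin.last _))), ?_,
      (map_ne_zero (iota pp.1 ((presAtPr X hlog pp).kk e) (Fin.last _))).mpr (ht0 pp i _)⟩
    have h := Set.smul_mem_smul_set (a := iota pp.1 ((presAtPr X hlog pp).kk e) (Fin.last _) (t pp i (e (Fin.last _))))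
      (Subring.one_mem (normalizedPacket pp.1 ((presAtPr X hlog pp).kk e)) : (1 : (presAtPr X hlog pp).X e) ∈
        (normalizedPacket pp.1 ((presAtPr X hlog pp).kk e) : Set ((presAtPr X hlog pp).X e)))
    rwa [smul_eq_mul, mul_one] at h
  have hex := fun e : (thetaIndex X).Caps (Setting.labelSucc i) → (thetaIndex X).Fibre (.inr pp) =>
    exists_content pp.1 ((presAtPr X hlog pp).kk e) (isPsiBounded_smul_normalizedPacket pp.1 ((presAtPr X hlog pp).kk e) _) (hne e)
  choose m hm0 hm1 using hex
  -- by the exact cell (norm only, slot-independent) every slot box has the same content as the last one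
  have hslot : ∀ (e : (thetaIndex X).Caps (Setting.labelSucc i) → (thetaIndex X).Fibre (.inr pp)) (a : (thetaIndex X).Caps (Setting.labelSucc i))
      (m' : ℤ),
      iota pp.1 ((presAtPr X hlog pp).kk e) a (t pp i (e a)) •
          (normalizedPacket pp.1 ((presAtPr X hlog pp).kk e) : Set ((presAtPr X hlog pp).X e)) ⊆
        (((pp : ℕ) : ℚ_[pp]) ^ m') • (logPacket pp.1 ((presAtPr X hlog pp).kk e) : Set ((presAtPr X hlog pp).X e)) ↔
      iota pp.1 ((presAtPr X hlog pp).kk e) (Fin.last _) (t pp i (e (Fin.last _))) •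
          (normalizedPacket pp.1 ((presAtPr X hlog pp).kk e) : Set ((presAtPr X hlog pp).X e)) ⊆
        (((pp : ℕ) : ℚ_[pp]) ^ m') • (logPacket pp.1 ((presAtPr X hlog pp).kk e) : Set ((presAtPr X hlog pp).X e)) := by
    intro e a m'
    have hnum : ((pp : ℕ) : ℝ) ^ m' * ‖t pp i (e a)‖ = ((pp : ℕ) : ℝ) ^ m' * ‖t pp i (e (Fin.last _))‖ := by
      rw [hΘ (e a) (e (Fin.last _))]
    rw [iota_smul_normalizedPacket_subset_zpow_smul_logPacket_iff pp.1 ((presAtPr X hlog pp).kk e)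
        (c := fun b => cin (e b)) (fun b => hin0 (e b)) (fun b => hin (e b)) (fun b => hmax (e b)) a _ m',
      iota_smul_normalizedPacket_subset_zpow_smul_logPacket_iff pp.1 ((presAtPr X hlog pp).kk e)
        (c := fun b => cin (e b)) (fun b => hin0 (e b)) (fun b => hin (e b)) (fun b => hmax (e b)) (Fin.last _) _ m']
    exact ⟨fun h J => (le_of_eq hnum.symm).trans (h J), fun h J => (le_of_eq hnum).trans (h J)⟩
  -- hence `m` is also the exact content of the slot UNION
  have hU0 : ∀ e : (thetaIndex X).Caps (Setting.labelSucc i) → (thetaIndex X).Fibre (.inr pp),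
      (⋃ a, iota pp.1 ((presAt X hlog pp).kk e) a (t pp i (e a)) •
          (normalizedPacket pp.1 ((presAt X hlog pp).kk e) : Set ((presAt X hlog pp).X e))) ⊆
        (((pp : ℕ) : ℚ_[pp]) ^ m e) • (logPacket pp.1 ((presAt X hlog pp).kk e) : Set ((presAt X hlog pp).X e)) :=
    fun e => Set.iUnion_subset fun a => (hslot e a (m e)).mpr (hm0 e)
  have hU1 : ∀ e : (thetaIndex X).Caps (Setting.labelSucc i) → (thetaIndex X).Fibre (.inr pp),
      ¬ (⋃ a, iota pp.1 ((presAt X hlog pp).kk e) a (t pp i (e a)) •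
          (normalizedPacket pp.1 ((presAt X hlog pp).kk e) : Set ((presAt X hlog pp).X e))) ⊆
        (((pp : ℕ) : ℚ_[pp]) ^ (m e + 1)) • (logPacket pp.1 ((presAt X hlog pp).kk e) : Set ((presAt X hlog pp).X e)) :=
    fun e h => hm1 e ((Set.subset_iUnion (fun a => iota pp.1 ((presAtPr X hlog pp).kk e) a (t pp i (e a)) •
      (normalizedPacket pp.1 ((presAtPr X hlog pp).kk e) : Set ((presAtPr X hlog pp).X e))) (Fin.last _)).trans h)
  -- the (P) criterion wants the last-slot boxes in `labelIdele` form
  have hP0 : ∀ e : (thetaIndex X).Caps (Setting.labelSucc i) → (thetaIndex X).Fibre (.inr pp),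
      iota pp.1 ((presAtPr X hlog pp).kk e) (Fin.last _) ((presAtPr X hlog pp).labelIdele (t pp) (Setting.labelSucc i) (e (Fin.last _))) •
          (normalizedPacket pp.1 ((presAtPr X hlog pp).kk e) : Set ((presAtPr X hlog pp).X e)) ⊆
        (((pp : ℕ) : ℚ_[pp]) ^ m e) • (logPacket pp.1 ((presAtPr X hlog pp).kk e) : Set ((presAtPr X hlog pp).X e)) := by
    intro e; rw [PadicPresentation.labelIdele_labelSucc]; exact hm0 e
  have hP1 : ∀ e : (thetaIndex X).Caps (Setting.labelSucc i) → (thetaIndex X).Fibre (.inr pp),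
      ¬ iota pp.1 ((presAtPr X hlog pp).kk e) (Fin.last _) ((presAtPr X hlog pp).labelIdele (t pp) (Setting.labelSucc i) (e (Fin.last _))) •
          (normalizedPacket pp.1 ((presAtPr X hlog pp).kk e) : Set ((presAtPr X hlog pp).X e)) ⊆
        (((pp : ℕ) : ℚ_[pp]) ^ (m e + 1)) • (logPacket pp.1 ((presAtPr X hlog pp).kk e) : Set ((presAtPr X hlog pp).X e)) := by
    intro e; rw [PadicPresentation.labelIdele_labelSucc]; exact hm1 e
  rw [qRegion_subset_thetaSlotHull_settingPrVolSharp_iff_of_content X hlog M archPk archSub Ψ act Mmod region n lat sig split qData t tq htq0 htq1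
      (Setting.labelSucc i) pp m hP0 hP1 ν hνmem hν,
    qRegion_subset_thetaHull_settingPrVolSharp_iff_of_content_isMaxOn X hlog M archPk archSub Ψ act Mmod region n lat sig split qData tq t htq0
      htq1 i pp m hU0 hU1 ν hνmem hν]
  -- `p^m·‖t_q‖ ≤ ∏ν` versus `‖t_q‖ ≤ ‖p^m‖·∏ν`
  have hp0 : (0 : ℝ) < (pp : ℕ) := by exact_mod_cast pp.2.pos
  refine forall_congr' fun e => ?_
  rw [Padic.norm_p_zpow, zpow_neg, ← div_eq_inv_mul, le_div_iff₀ (zpow_pos hp0 _), mul_comm]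

/-! ## §2. The two licences coincide under fibrewise norm-constancy -/

/-- **`SlotLicence ↔ Licence` at the K-level sharp setting when, at every prime `p` and label `i`, the norms `‖t_{Θ,i,v}‖` are constant over `v ∣ p`**
(archimedean packet automatic on both sides: abc-iut-c312-7 `qRegion_settingPrVolSharp_inl`/`thetaRegion_settingPrVolSharp_inl` — everything is the
whole packet there). [cite: Mochizuki2012, IUTchIII Cor. 3.12 Step (xi-f) p. 184; Thm. 3.11 (i) (Ind1) p. 154] [cite: DupuyHilado2025, §4.11–4.12] -/
theorem slotLicence_iff_licence_settingPrVolSharp_of_norm_const (ht0 : ∀ pp i x, t pp i x ≠ 0)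
    (hΘ : ∀ (pp : Nat.Primes) (i : Fin (thetaIndex X).lstar) (x y : (thetaIndex X).Fibre (.inr pp)), ‖t pp i x‖ = ‖t pp i y‖) :
    (settingPrVolSharp X hlog M archPk archSub Ψ act Mmod region n lat sig split qData tq t htq0 htq1).SlotLicence ↔ Thm311ToCor312.Licence (settingPrVolSharp X hlog M archPk archSub Ψ act Mmod region n lat sig split qData tq t htq0 htq1) := by
  refine forall_congr' fun i => forall_congr' fun vQ => ?_
  rcases vQ with u | pp
  · refine ⟨fun _ => ?_, fun _ => qRegion_subset_thetaSlotHull_settingPrVolSharp_inl X hlog M archPk archSub Ψ act Mmod region n lat sig split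
      qData t tq htq0 htq1 _ u⟩
    exact (qRegion_subset_thetaSlotHull_settingPrVolSharp_inl X hlog M archPk archSub Ψ act Mmod region n lat sig split qData t tq htq0 htq1
      _ u).trans ((settingPrVolSharp X hlog M archPk archSub Ψ act Mmod region n lat sig split qData tq t htq0 htq1).thetaSlotHull_subset_thetaHull _ _)
  · exact qRegion_subset_thetaSlotHull_iff_thetaHull_settingPrVolSharp_of_norm_const X hlog M archPk archSub Ψ act Mmod region n lat sig split
      qData t tq htq0 htq1 ht0 i pp (hΘ pp i)

/-- Contrapositive: under fibrewise norm-constancy, **a failure of the SLOT licence is a failure of the (U) licence** (hence of the q-pinned S_H,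
abc-iut-w5-d068 `licence_of_pilotKummerCompatHull`). [folklore] -/
theorem not_licence_of_not_slotLicence_settingPrVolSharp_of_norm_const (ht0 : ∀ pp i x, t pp i x ≠ 0)
    (hΘ : ∀ (pp : Nat.Primes) (i : Fin (thetaIndex X).lstar) (x y : (thetaIndex X).Fibre (.inr pp)), ‖t pp i x‖ = ‖t pp i y‖)
    (hns : ¬ (settingPrVolSharp X hlog M archPk archSub Ψ act Mmod region n lat sig split qData tq t htq0 htq1).SlotLicence) :
    ¬ Thm311ToCor312.Licence (settingPrVolSharp X hlog M archPk archSub Ψ act Mmod region n lat sig split qData tq t htq0 htq1) :=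
  fun hlic => hns ((slotLicence_iff_licence_settingPrVolSharp_of_norm_const X hlog M archPk archSub Ψ act Mmod region n lat sig split qData t tq
    htq0 htq1 ht0 hΘ).mpr hlic)

end Summit.ABC.IUTFork.Thm311.Real

end
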